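import Mathlib
import HarnessLib
import Literature.NumberTheory.Transcendental.MZVSimplexRepProofs
import Literature.NumberTheory.Transcendental.BeukersZetaThreeIntegralsLegendreProofs
import Summits.KontsevichZagierPeriods.KontsevichZagierPeriods.Theorems.LinRedNormalFormDihedralNormalFormStubCellZetaMovesLowAux1

/-!
# Stub `stub_cellZetaMovesThree` of line `tame-bv-stokes` (crux `DihedralNormalForm`) — tools I

Support file for the stub `stub_cellZetaMovesThree` (the cell `ℓ = 3` of the cellular zeta
reduction): **residues of a convergent Arnold combination on the open 3-simplex along the two
facets `t₂ → 0` and `t₂ → t₁`.** The 24 Arnold products `∏ᵢ 1/(tᵢ - aᵢ)` (letters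
`α_a ∈ {0,1}`, `β_b ∈ {0,1,t₀}`, `γ_d ∈ {0,1,t₀,t₁}`, indexed by `Fin 2 × Fin 3 × Fin 4`) carry the
combination `Φ_c = Σ c_{abd} /((t₀-α_a)(t₁-β_b)(t₂-γ_d))` with a real coefficient table `c`; if
`Φ_c` is absolutely integrable on `X = {1 > t₀ > t₁ > t₂ > 0}` then `c_{ab0} = c_{ab3} = 0` for
all `a, b` (`cellZeta3_facet`, registered sub-goal `stub_cellZetaMovesThreeAux1`).

Proof (the pattern of `cellZeta_six`, tools file `…StubCellZetaMovesLowAux1`, one dimension up):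
by Tonelli along the last coordinate (`MeasurableEquiv.piFinSuccAbove`) almost every slice
`x ↦ Φ_c(y₀, y₁, x)` on `(0, y₁)` is integrable (`cellZeta3_slices`); the slice is
`K₀(y)/x + K₁(y)/(x-1) + K₂(y)/(x-y₀) + K₃(y)/(x-y₁)` with the residue functions
`K_d(y) = Σ_{a,b} c_{abd}/((y₀-α_a)(y₁-β_b))`, so `K₀(y) = K₃(y) = 0` (`cellZeta3_four_poles`, from
`cellZeta_residue_left/right`) for almost every, hence (continuity, Lebesgue measure charges open
sets) every `y` in the open 2-simplex; evaluating at six rational points, the six functions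
`1/((y₀-α)(y₁-β))` being linearly independent, gives the twelve vanishing coefficients (explicit
elimination certified by `linear_combination`).

References: M. Kontsevich, D. Zagier, *Periods* (2001), §1.1 (absolute convergence is part of the
definition of a period); F. Brown, S. Carr, L. Schneps, *The algebra of cell-zeta values*,
Compositio Math. 146 (2010), §4.4.1.
-/

noncomputable section

open MeasureTheory Set
open Literature.NumberTheory.Transcendental

namespace Summit.KontsevichZagierPeriods.DihedralNormalForm.TameBVStokes

/-- Membership in the open 2-simplex, typed. [folklore] -/
theorem cellZeta3_mem_simplex2 {y : Fin 2 → ℝ} :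
    y ∈ {t : Fin 2 → ℝ | (∀ i, 0 < t i) ∧ (∀ i, t i < 1) ∧ StrictAnti t} ↔
      1 > y 0 ∧ y 0 > y 1 ∧ y 1 > 0 := by
  simp only [mem_setOf_eq, Fin.forall_fin_two]
  constructor
  · rintro ⟨⟨h0, h1⟩, ⟨h2, h3⟩, h4⟩
    exact ⟨h2, h4 (show (0 : Fin 2) < 1 by decide), h1⟩
  · rintro ⟨h0, h1, h2⟩
    refine ⟨⟨by linarith, h2⟩, ⟨h0, by linarith⟩, ?_⟩
    rw [Fin.strictAnti_iff_succ_lt]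
    intro i
    fin_cases i
    simpa using h1

/-- **Tonelli on the 3-simplex along the last coordinate.** If `G` is integrable on
`{1 > t₀ > t₁ > t₂ > 0}`, then for almost every `(y₀, y₁)` in the open 2-simplex the slice
`x ↦ G(y₀, y₁, x)` is integrable on `(0, y₁)`. [folklore] -/
theorem cellZeta3_slices (G : (Fin 3 → ℝ) → ℝ)
    (hG : IntegrableOn G {t : Fin 3 → ℝ | (∀ i, 0 < t i) ∧ (∀ i, t i < 1) ∧ StrictAnti t}) :
    ∀ᵐ y : Fin 2 → ℝ, y ∈ {t : Fin 2 → ℝ | (∀ i, 0 < t i) ∧ (∀ i, t i < 1) ∧ StrictAnti t} →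
      IntegrableOn (fun x => G ![y 0, y 1, x]) (Ioo 0 (y 1)) := by
  set S : Set (Fin 3 → ℝ) := {t | (∀ i, 0 < t i) ∧ (∀ i, t i < 1) ∧ StrictAnti t} with hS
  set e := MeasurableEquiv.piFinSuccAbove (fun _ => ℝ) (2 : Fin 3) with he
  have hmp : MeasurePreserving e.symm volume volume :=
    (volume_preserving_piFinSuccAbove (fun _ => ℝ) (2 : Fin 3)).symm e
  have he_symm : ∀ p : ℝ × (Fin 2 → ℝ), e.symm p = ![p.2 0, p.2 1, p.1] := fun p => by
    rw [← Beukers.insertNth_two_eq]; rfl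
  have hSm : MeasurableSet S := KZ.measurableSet_openOrderedSimplex 3
  have h1 : IntegrableOn (G ∘ e.symm) (e.symm ⁻¹' S) volume :=
    (hmp.integrableOn_comp_preimage e.symm.measurableEmbedding).2 hG
  set S' : Set (ℝ × (Fin 2 → ℝ)) := {p | (1 > p.2 0 ∧ p.2 0 > p.2 1 ∧ p.2 1 > 0) ∧
    0 < p.1 ∧ p.1 < p.2 1} with hS'
  have hT : e.symm ⁻¹' S = S' := by
    ext p
    rw [mem_preimage, he_symm, hS, hS']
    simp only [mem_setOf_eq, Fin.forall_fin_succ, IsEmpty.forall_iff, and_true,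
      Fin.succ_zero_eq_one, Fin.succ_one_eq_two, Matrix.cons_val_zero, Matrix.cons_val_one,
      Matrix.cons_val_two, Matrix.head_cons, Matrix.tail_cons]
    constructor
    · rintro ⟨⟨h0, h1, h2⟩, ⟨h3, h4, h5⟩, h6⟩
      have h01 : p.2 1 < p.2 0 := by simpa using h6 (show (0 : Fin 3) < 1 by decide)
      have h12 : p.1 < p.2 1 := by simpa using h6 (show (1 : Fin 3) < 2 by decide)
      exact ⟨⟨h3, h01, h1⟩, h2, h12⟩
    · rintro ⟨⟨h0, h01, h1⟩, h2, h12⟩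
      refine ⟨⟨by linarith, h1, h2⟩, ⟨h0, by linarith, by linarith⟩, ?_⟩
      rw [Fin.strictAnti_iff_succ_lt]
      intro i
      fin_cases i
      · simpa using h01
      · simpa using h12
  rw [hT] at h1
  have hTm : MeasurableSet S' := by
    rw [← hT]; exact hSm.preimage e.symm.measurable
  have h2 : Integrable (S'.indicator (G ∘ e.symm)) ((volume : Measure ℝ).prod volume) := by
    rw [← Measure.volume_eq_prod]
    exact (integrable_indicator_iff hTm).2 h1
  filter_upwards [h2.prod_left_ae] with y hy hyT
  have hyT' : 1 > y 0 ∧ y 0 > y 1 ∧ y 1 > 0 := cellZeta3_mem_simplex2.1 hyT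
  have h3 : (fun x => S'.indicator (G ∘ e.symm) (x, y)) =
      (Ioo 0 (y 1)).indicator (fun x => G ![y 0, y 1, x]) := by
    funext x
    by_cases hx : x ∈ Ioo 0 (y 1)
    · rw [indicator_of_mem hx, indicator_of_mem (show (x, y) ∈ S' from ⟨hyT', hx.1, hx.2⟩)]
      show G (e.symm (x, y)) = _
      rw [he_symm]
    · rw [indicator_of_notMem hx, indicator_of_notMem]
      rintro ⟨-, h0, h1⟩
      exact hx ⟨h0, h1⟩
  rw [h3, integrable_indicator_iff measurableSet_Ioo] at hy
  exact hy

/-- **Four poles.** If `K₀/x + K₁/(x-1) + K₂/(x-y₀) + K₃/(x-y₁)` is integrable on `(0, y₁)`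
(`1 > y₀ > y₁ > 0`), then `K₀ = K₃ = 0` (`cellZeta_residue_left/right`). [folklore] -/
theorem cellZeta3_four_poles (K₀ K₁ K₂ K₃ y₀ y₁ : ℝ) (hy : 1 > y₀ ∧ y₀ > y₁ ∧ y₁ > 0)
    (h : IntegrableOn (fun x : ℝ => K₀ * (1 / x) + K₁ * (1 / (x - 1)) + K₂ * (1 / (x - y₀)) +
      K₃ * (1 / (x - y₁))) (Ioo 0 y₁)) : K₀ = 0 ∧ K₃ = 0 := by
  obtain ⟨h0, h01, h1⟩ := hy
  constructor
  · have hB : ContinuousOn (fun x : ℝ => K₁ * (1 / (x - 1)) + K₂ * (1 / (x - y₀)) +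
        K₃ * (1 / (x - y₁))) (Icc 0 (y₁ / 2)) := by
      have e1 : ∀ x ∈ Icc (0:ℝ) (y₁ / 2), x - 1 ≠ 0 := fun x hx => by
        intro h; linarith [hx.2, sub_eq_zero.1 h]
      have e2 : ∀ x ∈ Icc (0:ℝ) (y₁ / 2), x - y₀ ≠ 0 := fun x hx => by
        intro h; linarith [hx.2, sub_eq_zero.1 h]
      have e3 : ∀ x ∈ Icc (0:ℝ) (y₁ / 2), x - y₁ ≠ 0 := fun x hx => by
        intro h; linarith [hx.2, sub_eq_zero.1 h]
      exact ((continuousOn_const.mul (continuousOn_const.div (by fun_prop) e1)).add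
        (continuousOn_const.mul (continuousOn_const.div (by fun_prop) e2))).add
        (continuousOn_const.mul (continuousOn_const.div (by fun_prop) e3))
    have hab : (0:ℝ) < y₁ / 2 := by linarith
    refine cellZeta_residue_left hab
      ((hB.integrableOn_compact isCompact_Icc).mono_set Ioo_subset_Icc_self)
      (h.mono_set (Ioo_subset_Ioo_right (by linarith))) fun x _ => ?_
    simp only [sub_zero, one_div]
    ring
  · have hB : ContinuousOn (fun x : ℝ => K₀ * (1 / x) + K₁ * (1 / (x - 1)) +
        K₂ * (1 / (x - y₀))) (Icc (y₁ / 2) y₁) := by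
      have e1 : ∀ x ∈ Icc (y₁ / 2) y₁, x ≠ 0 := fun x hx => by
        intro h; linarith [hx.1]
      have e2 : ∀ x ∈ Icc (y₁ / 2) y₁, x - 1 ≠ 0 := fun x hx => by
        intro h; linarith [hx.2, sub_eq_zero.1 h]
      have e3 : ∀ x ∈ Icc (y₁ / 2) y₁, x - y₀ ≠ 0 := fun x hx => by
        intro h; linarith [hx.2, sub_eq_zero.1 h]
      exact ((continuousOn_const.mul (continuousOn_const.div (by fun_prop) e1)).add
        (continuousOn_const.mul (continuousOn_const.div (by fun_prop) e2))).add
        (continuousOn_const.mul (continuousOn_const.div (by fun_prop) e3))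
    have hab : y₁ / 2 < y₁ := by linarith
    refine cellZeta_residue_right hab
      ((hB.integrableOn_compact isCompact_Icc).mono_set Ioo_subset_Icc_self)
      (h.mono_set (Ioo_subset_Ioo_left (by linarith))) fun x _ => ?_
    simp only [one_div]
    ring

/-- A function continuous on the open 2-simplex and vanishing almost everywhere there vanishes
there (Lebesgue measure charges open sets). [folklore] -/
theorem cellZeta3_ae_zero2 {g : (Fin 2 → ℝ) → ℝ}
    (hg : ContinuousOn g {t : Fin 2 → ℝ | (∀ i, 0 < t i) ∧ (∀ i, t i < 1) ∧ StrictAnti t})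
    (h : ∀ᵐ y : Fin 2 → ℝ, y ∈ {t : Fin 2 → ℝ | (∀ i, 0 < t i) ∧ (∀ i, t i < 1) ∧ StrictAnti t} →
      g y = 0) :
    ∀ y ∈ {t : Fin 2 → ℝ | (∀ i, 0 < t i) ∧ (∀ i, t i < 1) ∧ StrictAnti t}, g y = 0 := by
  have h1 : g =ᵐ[volume.restrict {t : Fin 2 → ℝ | (∀ i, 0 < t i) ∧ (∀ i, t i < 1) ∧ StrictAnti t}]
      (fun _ => (0:ℝ)) :=
    (ae_restrict_iff' (KZ.measurableSet_openOrderedSimplex 2)).2 h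
  exact Measure.eqOn_open_of_ae_eq h1 (KZ.isOpen_openOrderedSimplex 2) hg continuousOn_const

/-- The residue functions `K_d(y) = Σ_{a,b} c_{abd}/((y₀-α_a)(y₁-β_b))` are continuous on the
open 2-simplex. [folklore] -/
theorem cellZeta3_residue_continuousOn (c : Fin 2 → Fin 3 → Fin 4 → ℝ) (d : Fin 4) :
    ContinuousOn (fun y : Fin 2 → ℝ => ∑ a : Fin 2, ∑ b : Fin 3, c a b d *
        ((1 / (y 0 - (![0, 1] : Fin 2 → ℝ) a)) * (1 / (y 1 - (![0, 1, y 0] : Fin 3 → ℝ) b))))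
      {t : Fin 2 → ℝ | (∀ i, 0 < t i) ∧ (∀ i, t i < 1) ∧ StrictAnti t} := by
  refine continuousOn_finsetSum _ fun a _ => continuousOn_finsetSum _ fun b _ =>
    continuousOn_const.mul (ContinuousOn.mul ?_ ?_)
  · refine continuousOn_const.div (by fun_prop) fun y hy => ?_
    rw [cellZeta3_mem_simplex2] at hy
    fin_cases a
    · simp; linarith
    · simp; linarith
  · fin_cases b
    · refine continuousOn_const.div (by simp; fun_prop) fun y hy => ?_
      rw [cellZeta3_mem_simplex2] at hy
      simp; linarith
    · refine continuousOn_const.div (by simp; fun_prop) fun y hy => ?_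
      rw [cellZeta3_mem_simplex2] at hy
      simp; linarith
    · refine continuousOn_const.div (by simp; fun_prop) fun y hy => ?_
      rw [cellZeta3_mem_simplex2] at hy
      simp; linarith

/-- **The facet residues `t₂ → 0` and `t₂ → t₁`.** If the 24-term Arnold combination
`Σ c_{abd} /((t₀-α_a)(t₁-β_b)(t₂-γ_d))` is integrable on the open 3-simplex, then the
coefficients of the letters `γ = 0` and `γ = t₁` vanish. [cite: KontsevichZagier2001, §1.1] -/
theorem cellZeta3_facet (c : Fin 2 → Fin 3 → Fin 4 → ℝ)
    (h : IntegrableOn (fun u : Fin 3 → ℝ => ∑ a : Fin 2, ∑ b : Fin 3, ∑ d : Fin 4, c a b d *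
        ((1 / (u 0 - (![0, 1] : Fin 2 → ℝ) a)) * (1 / (u 1 - (![0, 1, u 0] : Fin 3 → ℝ) b)) *
          (1 / (u 2 - (![0, 1, u 0, u 1] : Fin 4 → ℝ) d))))
      {t : Fin 3 → ℝ | (∀ i, 0 < t i) ∧ (∀ i, t i < 1) ∧ StrictAnti t}) :
    (∀ a b, c a b 0 = 0) ∧ (∀ a b, c a b 3 = 0) := by
  have hsl := cellZeta3_slices _ h
  have hK : ∀ᵐ y : Fin 2 → ℝ, y ∈ {t : Fin 2 → ℝ | (∀ i, 0 < t i) ∧ (∀ i, t i < 1) ∧ StrictAnti t} →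
      (∑ a : Fin 2, ∑ b : Fin 3, c a b 0 *
        ((1 / (y 0 - (![0, 1] : Fin 2 → ℝ) a)) * (1 / (y 1 - (![0, 1, y 0] : Fin 3 → ℝ) b)))) = 0 ∧
      (∑ a : Fin 2, ∑ b : Fin 3, c a b 3 *
        ((1 / (y 0 - (![0, 1] : Fin 2 → ℝ) a)) * (1 / (y 1 - (![0, 1, y 0] : Fin 3 → ℝ) b)))) = 0 := by
    filter_upwards [hsl] with y hy hyT
    have hyT' : 1 > y 0 ∧ y 0 > y 1 ∧ y 1 > 0 := cellZeta3_mem_simplex2.1 hyT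
    have hI := hy hyT
    simp only [Matrix.cons_val_zero, Matrix.cons_val_one, Matrix.cons_val_two, Matrix.head_cons,
      Matrix.tail_cons] at hI
    refine cellZeta3_four_poles _
      (∑ a : Fin 2, ∑ b : Fin 3, c a b 1 *
        ((1 / (y 0 - (![0, 1] : Fin 2 → ℝ) a)) * (1 / (y 1 - (![0, 1, y 0] : Fin 3 → ℝ) b))))
      (∑ a : Fin 2, ∑ b : Fin 3, c a b 2 *
        ((1 / (y 0 - (![0, 1] : Fin 2 → ℝ) a)) * (1 / (y 1 - (![0, 1, y 0] : Fin 3 → ℝ) b))))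
      _ (y 0) (y 1) hyT' (hI.congr_fun (fun x _ => ?_) measurableSet_Ioo)
    simp only [Fin.sum_univ_two, Fin.sum_univ_three, Fin.sum_univ_four, Matrix.cons_val_zero,
      Matrix.cons_val_one, Matrix.cons_val_two, Matrix.cons_val_three, Matrix.head_cons,
      Matrix.tail_cons]
    ring
  have hK0 := cellZeta3_ae_zero2 (cellZeta3_residue_continuousOn c 0)
    (hK.mono fun y hy hyT => (hy hyT).1)
  have hK3 := cellZeta3_ae_zero2 (cellZeta3_residue_continuousOn c 3)
    (hK.mono fun y hy hyT => (hy hyT).2)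
  have m1 : (![1 / 2, 1 / 4] : Fin 2 → ℝ) ∈
      {t : Fin 2 → ℝ | (∀ i, 0 < t i) ∧ (∀ i, t i < 1) ∧ StrictAnti t} := by
    rw [cellZeta3_mem_simplex2]; norm_num
  have m2 : (![1 / 2, 1 / 3] : Fin 2 → ℝ) ∈
      {t : Fin 2 → ℝ | (∀ i, 0 < t i) ∧ (∀ i, t i < 1) ∧ StrictAnti t} := by
    rw [cellZeta3_mem_simplex2]; norm_num
  have m3 : (![2 / 3, 1 / 2] : Fin 2 → ℝ) ∈
      {t : Fin 2 → ℝ | (∀ i, 0 < t i) ∧ (∀ i, t i < 1) ∧ StrictAnti t} := by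
    rw [cellZeta3_mem_simplex2]; norm_num
  have m4 : (![1 / 3, 1 / 6] : Fin 2 → ℝ) ∈
      {t : Fin 2 → ℝ | (∀ i, 0 < t i) ∧ (∀ i, t i < 1) ∧ StrictAnti t} := by
    rw [cellZeta3_mem_simplex2]; norm_num
  have m5 : (![1 / 2, 1 / 6] : Fin 2 → ℝ) ∈
      {t : Fin 2 → ℝ | (∀ i, 0 < t i) ∧ (∀ i, t i < 1) ∧ StrictAnti t} := by
    rw [cellZeta3_mem_simplex2]; norm_num
  have m6 : (![2 / 3, 1 / 6] : Fin 2 → ℝ) ∈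
      {t : Fin 2 → ℝ | (∀ i, 0 < t i) ∧ (∀ i, t i < 1) ∧ StrictAnti t} := by
    rw [cellZeta3_mem_simplex2]; norm_num
  constructor
  · have e1 := hK0 _ m1
    have e2 := hK0 _ m2
    have e3 := hK0 _ m3
    have e4 := hK0 _ m4
    have e5 := hK0 _ m5
    have e6 := hK0 _ m6
    simp only [Fin.sum_univ_two, Fin.sum_univ_three, Matrix.cons_val_zero, Matrix.cons_val_one,
      Matrix.cons_val_two, Matrix.head_cons, Matrix.tail_cons] at e1 e2 e3 e4 e5 e6
    have k00 : c 0 0 0 = 0 := by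
      linear_combination (-3/16 : ℝ) * e1 + (-1/9 : ℝ) * e2 + (1/12 : ℝ) * e3 + (1/18 : ℝ) * e4 + (2/9 : ℝ) * e5 + (-1/12 : ℝ) * e6
    have k01 : c 0 1 0 = 0 := by
      linear_combination (-15/8 : ℝ) * e1 + (5/12 : ℝ) * e3 + (5/9 : ℝ) * e4 + (5/12 : ℝ) * e6
    have k02 : c 0 2 0 = 0 := by
      linear_combination (-3/16 : ℝ) * e1 + (1/9 : ℝ) * e2 + (-1/6 : ℝ) * e4 + (4/9 : ℝ) * e5 + (-1/6 : ℝ) * e6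
    have k10 : c 1 0 0 = 0 := by
      linear_combination (3/16 : ℝ) * e1 + (-2/9 : ℝ) * e2 + (1/12 : ℝ) * e3 + (1/18 : ℝ) * e4 + (-1/18 : ℝ) * e5 + (-1/12 : ℝ) * e6
    have k11 : c 1 1 0 = 0 := by
      linear_combination (15/8 : ℝ) * e1 + (-5/3 : ℝ) * e2 + (5/12 : ℝ) * e3 + (5/9 : ℝ) * e4 + (-5/3 : ℝ) * e5 + (5/12 : ℝ) * e6
    have k12 : c 1 2 0 = 0 := by
      linear_combination (-15/16 : ℝ) * e1 + (5/9 : ℝ) * e2 + (-1/6 : ℝ) * e4 + (13/18 : ℝ) * e5 + (-1/6 : ℝ) * e6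
    intro a b
    fin_cases a <;> fin_cases b <;> assumption
  · have e1 := hK3 _ m1
    have e2 := hK3 _ m2
    have e3 := hK3 _ m3
    have e4 := hK3 _ m4
    have e5 := hK3 _ m5
    have e6 := hK3 _ m6
    simp only [Fin.sum_univ_two, Fin.sum_univ_three, Matrix.cons_val_zero, Matrix.cons_val_one,
      Matrix.cons_val_two, Matrix.head_cons, Matrix.tail_cons] at e1 e2 e3 e4 e5 e6
    have k00 : c 0 0 3 = 0 := by
      linear_combination (-3/16 : ℝ) * e1 + (-1/9 : ℝ) * e2 + (1/12 : ℝ) * e3 + (1/18 : ℝ) * e4 + (2/9 : ℝ) * e5 + (-1/12 : ℝ) * e6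
    have k01 : c 0 1 3 = 0 := by
      linear_combination (-15/8 : ℝ) * e1 + (5/12 : ℝ) * e3 + (5/9 : ℝ) * e4 + (5/12 : ℝ) * e6
    have k02 : c 0 2 3 = 0 := by
      linear_combination (-3/16 : ℝ) * e1 + (1/9 : ℝ) * e2 + (-1/6 : ℝ) * e4 + (4/9 : ℝ) * e5 + (-1/6 : ℝ) * e6
    have k10 : c 1 0 3 = 0 := by
      linear_combination (3/16 : ℝ) * e1 + (-2/9 : ℝ) * e2 + (1/12 : ℝ) * e3 + (1/18 : ℝ) * e4 + (-1/18 : ℝ) * e5 + (-1/12 : ℝ) * e6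
    have k11 : c 1 1 3 = 0 := by
      linear_combination (15/8 : ℝ) * e1 + (-5/3 : ℝ) * e2 + (5/12 : ℝ) * e3 + (5/9 : ℝ) * e4 + (-5/3 : ℝ) * e5 + (5/12 : ℝ) * e6
    have k12 : c 1 2 3 = 0 := by
      linear_combination (-15/16 : ℝ) * e1 + (5/9 : ℝ) * e2 + (-1/6 : ℝ) * e4 + (13/18 : ℝ) * e5 + (-1/6 : ℝ) * e6
    intro a b
    fin_cases a <;> fin_cases b <;> assumption


/-! ### Registered sub-goal -/

/-- Registered sub-goal `stub_cellZetaMovesThreeAux1` of this file: the facet residues `t₂ → 0`,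
`t₂ → t₁` of a convergent Arnold combination on the open 3-simplex vanish (`cellZeta3_facet`). -/
theorem stub_cellZetaMovesThreeAux1 : ∀ (c : Fin 2 → Fin 3 → Fin 4 → ℝ), MeasureTheory.IntegrableOn (fun u : Fin 3 → ℝ => ∑ a : Fin 2, ∑ b : Fin 3, ∑ d : Fin 4, c a b d * ((1 / (u 0 - (![0, 1] : Fin 2 → ℝ) a)) * (1 / (u 1 - (![0, 1, u 0] : Fin 3 → ℝ) b)) * (1 / (u 2 - (![0, 1, u 0, u 1] : Fin 4 → ℝ) d)))) {t : Fin 3 → ℝ | (∀ i, 0 < t i) ∧ (∀ i, t i < 1) ∧ StrictAnti t} MeasureTheory.volume → (∀ a b, c a b 0 = 0) ∧ (∀ a b, c a b 3 = 0) :=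
  fun c h => cellZeta3_facet c h

end Summit.KontsevichZagierPeriods.DihedralNormalForm.TameBVStokes
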